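import Literature.MathematicalPhysics.QuantumManyBody.BoseGasWallCutoff
import Literature.MathematicalPhysics.QuantumManyBody.BoseGasDirichletMonotonicity
import HarnessLib

/-!
# Cutting a Dirichlet trial state down to a smaller box near the top faces: the energy bookkeeping

Topic `Literature/MathematicalPhysics/QuantumManyBody`, grouping namespace `BoseGas.TopFaceCutoff`,
sequel of `BoseGasWallCutoff.lean` (the `C¹` wall profile and the pointwise bookkeeping of the product
cut-off `ψ ∏_{i,k} θ(x_{i,k})`) and `BoseGasDirichletMonotonicity.lean` (normalising an unnormalised
Dirichlet wave function, `groundStateEnergy_mul_normSq_le`). The variational ingredient of the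
**right-continuity of the Dirichlet ground-state energy in the box side**
(`BoseGasEnergyRightContinuity.lean`):

* `TopFaceCutoff.ennnormSq_fderiv_cut_le`, `TopFaceCutoff.kineticDensity_cut_le` — the pointwise
  kinetic bound WITH A YOUNG PARAMETER `α > 0`:
  `|∇(ψχ)|² ≤ (1+α)|∇ψ|² + (1+α⁻¹) D² ∑_{i,k} 1_{x_{i,k} > c} |ψ|²` for `0 ≤ θ ≤ 1`, `|θ'| ≤ D`,
  `θ' = 0` on `(-∞, c]` (the kinetic energy of `ψ` in the collar is DROPPED, not paid for);
* `TopFaceCutoff.groundStateEnergy_mul_le` — **the cut-down bound**: for every Dirichlet trial state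
  `Φ` of ANY box `Λ_{L'}`, every `L`, `h > 0` and `α > 0`, with the collar masses
  `m = ∑_{i,k} ∫_{x_{i,k} > L-h} |Φ|²`,
  `E₀(N, L) · (1 - m) ≤ (1+α) ⟨Φ, H Φ⟩ + (1+α⁻¹) (π/(2h))² · m`
  (cut `Φ` off with the product of wall profiles equal to `1` below `L - h` and to `0` above `L` in
  every coordinate: the product vanishes off `Λ_L^N` — below `0` because `Φ` does —, is `C¹` and Bose
  symmetric, its interaction only decreases (`χ ≤ 1`, potentials `≥ 0`, hard cores included), and
  `groundStateEnergy_mul_normSq_le` normalises it).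

Everything is elementary calculus over `[0,∞]`-valued integrals and is tagged folklore; the potential
`v` is arbitrary (no measurability, no finiteness). Not here: the choice of `h`, `α` and the
compactness argument that make the right side small (`BoseGasEnergyRightContinuity.lean`).

## References

* [LSSY2005] E. H. Lieb, R. Seiringer, J. P. Solovej, J. Yngvason, *The Mathematics of the Bose Gas
  and its Condensation* (2005), Ch. 2 (Dirichlet boxes, (2.3); box localisation in the proof of
  Thm 2.4 is the same IMS/Young bookkeeping).
-/

noncomputable section

namespace Literature.MathematicalPhysics.QuantumManyBody.BoseGas

open _root_.MeasureTheory _root_.Filter _root_.Set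
open scoped ENNReal NNReal Topology

namespace TopFaceCutoff

variable {N : ℕ} {θ : ℝ → ℝ}

/-! ### The kinetic bound with a Young parameter -/

/-- Young's inequality `‖a + b‖² ≤ (1 + α⁻¹)‖a‖² + (1 + α)‖b‖²` (`α > 0`). [folklore] -/
theorem norm_add_sq_le (a b : ℂ) {α : ℝ} (hα : 0 < α) :
    ‖a + b‖ ^ 2 ≤ (1 + α⁻¹) * ‖a‖ ^ 2 + (1 + α) * ‖b‖ ^ 2 := by
  have h1 : ‖a + b‖ ^ 2 ≤ (‖a‖ + ‖b‖) ^ 2 := pow_le_pow_left₀ (norm_nonneg _) (norm_add_le a b) 2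
  have h2 : α * ((1 + α⁻¹) * ‖a‖ ^ 2 + (1 + α) * ‖b‖ ^ 2 - (‖a‖ + ‖b‖) ^ 2) =
      (‖a‖ - α * ‖b‖) ^ 2 := by
    field_simp
    ring
  have h3 : 0 ≤ (1 + α⁻¹) * ‖a‖ ^ 2 + (1 + α) * ‖b‖ ^ 2 - (‖a‖ + ‖b‖) ^ 2 := by
    have h4 : 0 ≤ α * ((1 + α⁻¹) * ‖a‖ ^ 2 + (1 + α) * ‖b‖ ^ 2 - (‖a‖ + ‖b‖) ^ 2) := by
      rw [h2]; exact sq_nonneg _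
    exact le_of_mul_le_mul_left (by rw [mul_zero]; exact h4) hα
  linarith

/-- **Kinetic density of the cut-off product, per direction, with a Young parameter.** With
`0 ≤ θ ≤ 1`, `|θ'| ≤ D`, `θ' = 0` on `(-∞, c]` and `α > 0`:
`|∂_{i,k}(ψ χ)|² ≤ (1+α)|∂_{i,k}ψ|² + (1+α⁻¹) D² 1_{x_{i,k} > c} |ψ|²`
(`∂_{i,k}(ψχ) = ψ θ'(x_{i,k}) ∏' θ + χ ∂_{i,k}ψ`, `fderiv_cutoffState_single`). [folklore] -/
theorem ennnormSq_fderiv_cut_le (hθ : ContDiff ℝ 1 θ) (h01 : ∀ t, 0 ≤ θ t ∧ θ t ≤ 1) {D : ℝ}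
    (hD : ∀ t, |deriv θ t| ≤ D) {c : ℝ} (hc : ∀ t, deriv θ t ≠ 0 → t ∈ Ioi c)
    {ψ : Config N → ℂ} (hψ : ContDiff ℝ 1 ψ) {α : ℝ} (hα : 0 < α) (X : Config N) (i : Fin N)
    (k : Fin 3) :
    ((‖fderiv ℝ (fun X : Config N => ψ X * ((∏ p : Fin N × Fin 3, θ (X p.1 p.2) : ℝ) : ℂ)) X
        (Pi.single i (EuclideanSpace.single k (1 : ℝ)))‖₊ : ℝ≥0∞)) ^ 2 ≤
      ENNReal.ofReal (1 + α) *
          ((‖fderiv ℝ ψ X (Pi.single i (EuclideanSpace.single k (1 : ℝ)))‖₊ : ℝ≥0∞)) ^ 2 +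
        ENNReal.ofReal ((1 + α⁻¹) * D ^ 2) *
          {X : Config N | c < X i k}.indicator (fun X => ((‖ψ X‖₊ : ℝ≥0∞)) ^ 2) X := by
  classical
  have hf := fderiv_cutoffState_single hθ hψ 0 X i k
  simp only [add_zero] at hf
  rw [hf]
  set Q : ℝ := ∏ p : Fin N × Fin 3, θ (X p.1 p.2) with hQ
  set P : ℝ := ∏ p ∈ Finset.univ.erase (i, k), θ (X p.1 p.2) with hP
  set dψ : ℂ := fderiv ℝ ψ X (Pi.single i (EuclideanSpace.single k (1 : ℝ))) with hdψ
  have hQ01 := WallCutoff.prod_mem_unit (Finset.univ : Finset (Fin N × Fin 3))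
    (fun p => θ (X p.1 p.2)) fun p => h01 _
  have hP01 := WallCutoff.prod_mem_unit (Finset.univ.erase (i, k))
    (fun p : Fin N × Fin 3 => θ (X p.1 p.2)) fun p => h01 _
  have hD0 : 0 ≤ D := (abs_nonneg _).trans (hD 0)
  have hb : ‖(Q : ℂ) * dψ‖ ^ 2 ≤ ‖dψ‖ ^ 2 := by
    rw [norm_mul, Complex.norm_real, Real.norm_eq_abs, abs_of_nonneg hQ01.1, mul_pow]
    exact mul_le_of_le_one_left (sq_nonneg _) (pow_le_one₀ hQ01.1 hQ01.2)
  -- the indicator term as a real number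
  set ind : ℝ := if c < X i k then ‖ψ X‖ ^ 2 else 0 with hind
  have hind0 : 0 ≤ ind := by rw [hind]; split_ifs <;> positivity
  have hindE : {X : Config N | c < X i k}.indicator (fun X => ((‖ψ X‖₊ : ℝ≥0∞)) ^ 2) X =
      ENNReal.ofReal ind := by
    rw [hind]
    by_cases hX : c < X i k
    · rw [indicator_of_mem (show X ∈ {X : Config N | c < X i k} from hX), if_pos hX,
        ennnorm_sq_eq_ofReal]
    · rw [indicator_of_notMem (show X ∉ {X : Config N | c < X i k} from hX), if_neg hX,
        ENNReal.ofReal_zero]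
  have ha : ‖ψ X * ((deriv θ (X i k) * P : ℝ) : ℂ)‖ ^ 2 ≤ D ^ 2 * ind := by
    by_cases h0 : deriv θ (X i k) = 0
    · rw [h0, zero_mul, Complex.ofReal_zero, mul_zero, norm_zero, zero_pow two_ne_zero]
      positivity
    · have hX : c < X i k := hc _ h0
      rw [hind, if_pos hX, norm_mul, Complex.norm_real, Real.norm_eq_abs, abs_mul, mul_pow, mul_pow,
        sq_abs, sq_abs]
      have h1 : deriv θ (X i k) ^ 2 ≤ D ^ 2 := by
        rw [← sq_abs]; exact pow_le_pow_left₀ (abs_nonneg _) (hD _) 2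
      have h2 : P ^ 2 ≤ 1 := pow_le_one₀ hP01.1 hP01.2
      calc ‖ψ X‖ ^ 2 * (deriv θ (X i k) ^ 2 * P ^ 2) ≤ ‖ψ X‖ ^ 2 * (D ^ 2 * 1) := by
            gcongr
        _ = D ^ 2 * ‖ψ X‖ ^ 2 := by ring
  have hreal : ‖ψ X * ((deriv θ (X i k) * P : ℝ) : ℂ) + (Q : ℂ) * dψ‖ ^ 2 ≤
      (1 + α) * ‖dψ‖ ^ 2 + (1 + α⁻¹) * D ^ 2 * ind := by
    refine (norm_add_sq_le _ _ hα).trans ?_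
    have hα' : 0 ≤ 1 + α⁻¹ := by positivity
    nlinarith [mul_le_mul_of_nonneg_left ha hα',
      mul_le_mul_of_nonneg_left hb (by positivity : (0 : ℝ) ≤ 1 + α)]
  rw [hindE, ennnorm_sq_eq_ofReal, ennnorm_sq_eq_ofReal dψ, ← ENNReal.ofReal_mul (by positivity),
    ← ENNReal.ofReal_mul (by positivity), ← ENNReal.ofReal_add (by positivity) (by positivity)]
  exact ENNReal.ofReal_le_ofReal hreal

/-- **Kinetic density of the cut-off product with a Young parameter**:
`|∇(ψχ)|² ≤ (1+α)|∇ψ|² + (1+α⁻¹) D² ∑_{i,k} 1_{x_{i,k} > c} |ψ|²`. [folklore] -/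
theorem kineticDensity_cut_le (hθ : ContDiff ℝ 1 θ) (h01 : ∀ t, 0 ≤ θ t ∧ θ t ≤ 1) {D : ℝ}
    (hD : ∀ t, |deriv θ t| ≤ D) {c : ℝ} (hc : ∀ t, deriv θ t ≠ 0 → t ∈ Ioi c)
    {ψ : Config N → ℂ} (hψ : ContDiff ℝ 1 ψ) {α : ℝ} (hα : 0 < α) (X : Config N) :
    kineticDensity (fun X : Config N => ψ X * ((∏ p : Fin N × Fin 3, θ (X p.1 p.2) : ℝ) : ℂ)) X ≤
      ENNReal.ofReal (1 + α) * kineticDensity ψ X +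
        ENNReal.ofReal ((1 + α⁻¹) * D ^ 2) * ∑ i : Fin N, ∑ k : Fin 3,
          {X : Config N | c < X i k}.indicator (fun X => ((‖ψ X‖₊ : ℝ≥0∞)) ^ 2) X := by
  unfold kineticDensity
  rw [Finset.mul_sum, Finset.mul_sum, ← Finset.sum_add_distrib]
  refine Finset.sum_le_sum fun i _ => ?_
  rw [Finset.mul_sum, Finset.mul_sum, ← Finset.sum_add_distrib]
  refine Finset.sum_le_sum fun k _ => ?_
  exact ennnormSq_fderiv_cut_le hθ h01 hD hc hψ hα X i k

/-! ### The cut-down bound -/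

/-- The product cut-off is Bose symmetric (reindex the product by the permutation). [folklore] -/
theorem prod_comp_perm (θ : ℝ → ℝ) (σ : Equiv.Perm (Fin N)) (X : Config N) :
    ∏ p : Fin N × Fin 3, θ ((X ∘ σ) p.1 p.2) = ∏ p : Fin N × Fin 3, θ (X p.1 p.2) := by
  have h := cutoffState_comp_perm (q := θ) (ψ := fun _ : Config N => (1 : ℂ)) (fun _ _ => rfl) 0 σ X
  simp only [one_mul, Complex.ofReal_inj] at h
  exact h

/-- **Cutting a trial state down to a smaller box.** For every Dirichlet trial state `Φ` of any box
`Λ_{L'}`, every `L`, `h > 0` and `α > 0`, with the collar masses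
`m = ∑_{i,k} ∫_{x_{i,k} > L-h} |Φ|²`:
`E₀(N, L) · (1 - m) ≤ (1+α) ⟨Φ, H Φ⟩ + (1+α⁻¹) (π/(2h))² m`. The cut-off is the product over all
coordinates of the wall profile of `BoseGasWallCutoff` (`1` below `L - h`, `0` above `L`,
`|θ'| ≤ π/(2h)`); the potential `v ≥ 0` is arbitrary (`⊤` allowed). [folklore] -/
theorem groundStateEnergy_mul_le (v : ℝ → ℝ≥0∞) {L L' h α : ℝ} (hh : 0 < h) (hα : 0 < α)
    (Φ : TrialState N L') :
    groundStateEnergy v N L *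
        (1 - ∑ i : Fin N, ∑ k : Fin 3, ∫⁻ X in {X : Config N | L - h < X i k}, (‖Φ.ψ X‖₊ : ℝ≥0∞) ^ 2) ≤
      ENNReal.ofReal (1 + α) * energy v Φ +
        ENNReal.ofReal ((1 + α⁻¹) * (Real.pi / (2 * h)) ^ 2) *
          ∑ i : Fin N, ∑ k : Fin 3, ∫⁻ X in {X : Config N | L - h < X i k}, (‖Φ.ψ X‖₊ : ℝ≥0∞) ^ 2 := by
  classical
  -- the profile: `1` on `(-∞, L - h]`, `0` on `[L, ∞)`, `|θ'| ≤ π/(2h)`, `θ' = 0` off `(L - h, ∞)`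
  obtain ⟨θ, hθ, h01, hD, hc, h1, h0⟩ := WallCutoff.exists_wallProfile (L := L + h) (w := h) hh
  have hc' : ∀ t, deriv θ t ≠ 0 → t ∈ Ioi (L - h) := fun t ht => by
    have := hc t ht; simp only [mem_Ioi] at this ⊢; linarith
  have h1' : ∀ t, t ≤ L - h → θ t = 1 := fun t ht => h1 t (by linarith)
  have h0' : ∀ t, L ≤ t → θ t = 0 := fun t ht => h0 t (by linarith)
  -- the cut state
  set g : Config N → ℂ := fun X => Φ.ψ X * ((∏ p : Fin N × Fin 3, θ (X p.1 p.2) : ℝ) : ℂ) with hg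
  have hgC : ContDiff ℝ 1 g := by
    have h := contDiff_cutoffState hθ Φ.contDiff 0
    simp only [add_zero] at h
    exact h
  have hg0 : ∀ X, X ∉ boxN N L → g X = 0 := by
    intro X hX
    simp only [boxN, box, mem_setOf_eq, not_forall] at hX
    obtain ⟨i, k, hik⟩ := hX
    rw [mem_Ioo, not_and_or, not_lt, not_lt] at hik
    rcases hik with hle | hge
    · have : X ∉ boxN N L' := fun h => (lt_irrefl (0 : ℝ)) ((h i k).1.trans_le hle)
      simp only [hg, Φ.eq_zero X this, zero_mul]
    · have hz : ∏ p : Fin N × Fin 3, θ (X p.1 p.2) = 0 :=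
        Finset.prod_eq_zero (Finset.mem_univ (i, k)) (h0' _ hge)
      simp only [hg, hz, Complex.ofReal_zero, mul_zero]
  have hgσ : ∀ (σ : Equiv.Perm (Fin N)) (X : Config N), g (X ∘ σ) = g X := fun σ X => by
    simp only [hg, Φ.symm σ X, prod_comp_perm θ σ X]
  -- masses
  set S : Fin N → Fin 3 → Set (Config N) := fun i k => {X : Config N | L - h < X i k} with hS
  have hSm : ∀ i k, MeasurableSet (S i k) := fun i k => measurableSet_coordWall (L - h) i k
  set m : ℝ≥0∞ := ∑ i : Fin N, ∑ k : Fin 3, ∫⁻ X in S i k, (‖Φ.ψ X‖₊ : ℝ≥0∞) ^ 2 with hm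
  have hnormSq : Measurable fun X => ((‖Φ.ψ X‖₊ : ℝ≥0∞)) ^ 2 := measurable_normSq Φ.contDiff.continuous
  have hsum : ∫⁻ X, ∑ i : Fin N, ∑ k : Fin 3,
      (S i k).indicator (fun X => ((‖Φ.ψ X‖₊ : ℝ≥0∞)) ^ 2) X = m :=
    WallCutoff.lintegral_sum_sum_indicator (fun _ _ => hnormSq) hSm
  -- mass of the cut state: `1 ≤ ∫|g|² + m`
  have hmass : 1 - m ≤ ∫⁻ X, ((‖g X‖₊ : ℝ≥0∞)) ^ 2 := by
    rw [tsub_le_iff_right, ← Φ.norm_eq, ← hsum, ← lintegral_add_left (measurable_normSq hgC.continuous)]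
    exact lintegral_mono fun X => WallCutoff.ennnormSq_le_cut_add h1' Φ.ψ X
  -- form of the cut state
  have hform : ∫⁻ X, kineticDensity g X + interaction v X * ((‖g X‖₊ : ℝ≥0∞)) ^ 2 ≤
      ENNReal.ofReal (1 + α) * energy v Φ +
        ENNReal.ofReal ((1 + α⁻¹) * (Real.pi / (2 * h)) ^ 2) * m := by
    have hone : (1 : ℝ≥0∞) ≤ ENNReal.ofReal (1 + α) := by
      rw [← ENNReal.ofReal_one]; exact ENNReal.ofReal_le_ofReal (by linarith)
    have hpt : ∀ X, kineticDensity g X + interaction v X * ((‖g X‖₊ : ℝ≥0∞)) ^ 2 ≤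
        ENNReal.ofReal (1 + α) * (kineticDensity Φ.ψ X + interaction v X * ((‖Φ.ψ X‖₊ : ℝ≥0∞)) ^ 2) +
          ENNReal.ofReal ((1 + α⁻¹) * (Real.pi / (2 * h)) ^ 2) * ∑ i : Fin N, ∑ k : Fin 3,
            (S i k).indicator (fun X => ((‖Φ.ψ X‖₊ : ℝ≥0∞)) ^ 2) X := by
      intro X
      have hk := kineticDensity_cut_le hθ h01 hD hc' Φ.contDiff hα X
      have hp : interaction v X * ((‖g X‖₊ : ℝ≥0∞)) ^ 2 ≤
          ENNReal.ofReal (1 + α) * (interaction v X * ((‖Φ.ψ X‖₊ : ℝ≥0∞)) ^ 2) :=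
        calc interaction v X * ((‖g X‖₊ : ℝ≥0∞)) ^ 2
            ≤ interaction v X * ((‖Φ.ψ X‖₊ : ℝ≥0∞)) ^ 2 :=
              mul_le_mul_right (WallCutoff.ennnormSq_cut_le h01 Φ.ψ X) _
          _ = 1 * _ := (one_mul _).symm
          _ ≤ _ := mul_le_mul_left hone _
      calc _ ≤ (ENNReal.ofReal (1 + α) * kineticDensity Φ.ψ X +
            ENNReal.ofReal ((1 + α⁻¹) * (Real.pi / (2 * h)) ^ 2) * ∑ i : Fin N, ∑ k : Fin 3,
              (S i k).indicator (fun X => ((‖Φ.ψ X‖₊ : ℝ≥0∞)) ^ 2) X) +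
            ENNReal.ofReal (1 + α) * (interaction v X * ((‖Φ.ψ X‖₊ : ℝ≥0∞)) ^ 2) :=
            add_le_add hk hp
        _ = _ := by ring
    have hmeas : Measurable fun X => ENNReal.ofReal ((1 + α⁻¹) * (Real.pi / (2 * h)) ^ 2) *
        ∑ i : Fin N, ∑ k : Fin 3, (S i k).indicator (fun X => ((‖Φ.ψ X‖₊ : ℝ≥0∞)) ^ 2) X :=
      measurable_const.mul (Finset.measurable_sum _ fun i _ => Finset.measurable_sum _ fun k _ =>
        hnormSq.indicator (hSm i k))
    calc _ ≤ ∫⁻ X, ENNReal.ofReal (1 + α) *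
            (kineticDensity Φ.ψ X + interaction v X * ((‖Φ.ψ X‖₊ : ℝ≥0∞)) ^ 2) +
          ENNReal.ofReal ((1 + α⁻¹) * (Real.pi / (2 * h)) ^ 2) * ∑ i : Fin N, ∑ k : Fin 3,
            (S i k).indicator (fun X => ((‖Φ.ψ X‖₊ : ℝ≥0∞)) ^ 2) X := lintegral_mono hpt
      _ = _ := by
          rw [lintegral_add_right' _ hmeas.aemeasurable, lintegral_const_mul' _ _ ENNReal.ofReal_ne_top,
            lintegral_const_mul' _ _ ENNReal.ofReal_ne_top, hsum]
          rfl
  -- normalise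
  calc groundStateEnergy v N L * (1 - m)
      ≤ groundStateEnergy v N L * ∫⁻ X, ((‖g X‖₊ : ℝ≥0∞)) ^ 2 := mul_le_mul_right hmass _
    _ ≤ ∫⁻ X, kineticDensity g X + interaction v X * ((‖g X‖₊ : ℝ≥0∞)) ^ 2 :=
        groundStateEnergy_mul_normSq_le v hgC hg0 hgσ
    _ ≤ _ := hform

end TopFaceCutoff

end Literature.MathematicalPhysics.QuantumManyBody.BoseGas

end
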